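import Summits.BirchSwinnertonDyer.BirchSwinnertonDyer.Theses.ErratumRoadFive
import Summits.BirchSwinnertonDyer.BirchSwinnertonDyer.Theorems.ErratumRoadFiveErratumThm23SelfDualOfTwoVarCoreDivPin

/-!
# v4♭ (PROPOSED by bsd-stepL-imc-p1 g34, 2026-08-29; TURNKEY, NOT KEYED — W-79: the pen keys) of the birth skeleton `Lines/erratum_chain.lean`
# for crux `ErratumRoadFive.ErratumThm23SigmaLeSelfDual` (item stmt-BirchSwinnertonDyer-23253, F4♯†) — the registered v3‡ (52ed63b5208a16a9)
# with its ONE stub WEAKENED: the unit cofactor of the pin was IDLE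

This is the tree's v3‡ with EXACTLY two edits: (1) the ONE stub is S1♭† `stub_FW21_twoVarSigmaLeDivPinned_selfDual` := S1†
`stub_FW21_twoVarSigmaLeDivPinned_selfDual` with the pin clause `∃ u : (𝓞_ℂp⟦T_a⟧)ˣ, constantCoeff Q₂ = ↑u * Q` replaced by
`∃ c : 𝓞_ℂp⟦T_a⟧, constantCoeff Q₂ = c * Q` («the weight-`k` BDP frame `Q` DIVIDES the anticyclotomic restriction of the two-variable
divisor `Q₂`» — the cofactor is NOT asked to be a unit), every other character identical; (2) `_of` is the tree theorem
`Theorems.ErratumThm23TwoVariable.ErratumChainSelfDualDivPin.erratumThm23SigmaLeSelfDual_of_twoVarCoreDivPin_of_thm326` (imc-p1 g34,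
file `Theorems/ErratumRoadFiveErratumThm23SelfDualOfTwoVarCoreDivPin.lean`: the bodies of p663658 ∕ p665011 re-run with `⟨u, hu⟩ ↦ ⟨c, hc⟩`;
the pin is consumed ONLY by `DivPin.map_constantCoeff_le_span_of_le_span_of_eq_mul`, i.e. `Ideal.mul_mem_left` — unit-ness was never used).

WHY (idle-binder audit, imc-p1 g34): in v3‡'s `_of` (p670957 = p663658 + p665011 + p670492) the unit `u` of S1†'s conclusion enters only
`TwoVariableDescent.map_constantCoeff_le_span_of_le_span_of_eq_unit_mul`, whose proof is `Ideal.mul_mem_left`. So the crux follows from the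
WEAKER stub S1♭† by the same kernel argument (S1† ⟹ S1♭† binder for binder: `Theorems.ErratumThm23TwoVariable.DivPin.exists_divPin_of_exists_unitPin`;
the converse fails in general). S1♭† asks strictly LESS of the unrefereed sources: [FW21 Thm. 4.41] + App. B L. 7.22 + Cor. 7.21 and, on
`T_c = 0`, only that `L^Σ_p(g)` DIVIDES `𝓛^{Gr,Σ}_𝒦(g)|_{T_c=0} = (𝓛^{Hida}_{f⊗𝐠}·𝓛^{Katz}_𝒦·h_𝒦)|_{T_c=0}` in `𝓞_ℂp⟦T_a⟧` — NOT the
erratum's «= L^Σ_p(g) up to a p-adic unit» (p. 4, «same calculation as [CGS23, Prop. 1.4.5]»): neither the unit-ness of the weight-`k`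
CGS-type constant nor of `h_𝒦·𝓛^{Katz}_𝒦|_{T_c=0}` (think `p ∣ h_𝒦`) is needed by K2. Nothing downstream changes (`closes` and every
consumer take the crux F4♯†, not the stub). For the disprover: the ♭ pin is the sharper target (only a failure of DIVISIBILITY refutes it).

HISTORY (v1†–v3‡, imc-p1 g24–g26): see the tree's v3‡ header; (FIX)† ⟸ [W] = route item 23081 `HidaOrdinaryUnitRootFact` (RULING 72∕82 (b)).

* S1♭† `stub_FW21_twoVarSigmaLeDivPinned_selfDual` — THE OPEN CORE, ♭-pinned: [FW21 Thm. 4.41] Σ-imprimitive two-variable divisibility at the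
  self-dual twist `A_g^†` + App. B Cor. 7.21 ∕ L. 7.22 + «`L^Σ_p(g)` divides the anticyclotomic restriction» + [Hsi14 Thm. B].
* (no second stub) item 23081 `HidaOrdinaryUnitRootFact` BY NAME.

Composition (sorry-free, BY NAME): `ErratumThm23SigmaLeSelfDual_of hFW hW :=
  ErratumChainSelfDualDivPin.erratumThm23SigmaLeSelfDual_of_twoVarCoreDivPin_of_thm326 hFW hW`. ON KEYING: `ledger crux write
stmt-BirchSwinnertonDyer-23253 Lines/erratum_chain.lean --file <this>` + `ledger skeleton check … --crux stmt-BirchSwinnertonDyer-23253`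
(expected: `_of` concludes the crux BY NAME; closed=False; ONE stub `stub_FW21_twoVarSigmaLeDivPinned_selfDual` registered; S1† becomes
inactive «not in skeleton»). No summit statement and no crux is proved here; BSD is not advanced by this file. Stub statements by name: `Statement.stub_*`.

[claim: FouquetWan2021, Thm. 4.41, App. B Cor. 7.21, Lemma 7.22, status: under-review] [claim: Castella2018Erratum, Thm. 2.3, status: under-review]
[cite: JetchevSkinnerWan2017, §3.4, Lemma 3.4.1, Cor. 3.4.2] [cite: CastellaGrossiSkinner2025, Prop. 2.4.5] [cite: Hsieh2014, Thm. B]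
[cite: Castella2018Erratum, §2 (p. 2), Lemma 2.1] [cite: Wiles1988, Thm. 2.2]
-/

noncomputable section

-- D-0017: single-problem summit, the namespace repeats the problem name by design.
set_option linter.dupNamespace false

open scoped Classical

open PowerSeries NumberField IsDedekindDomain Field
  Literature.NumberTheory.EllipticCurves Literature.NumberTheory.EllipticCurves.ModularForms
  Literature.NumberTheory.EllipticCurves.BigGaloisRep Literature.NumberTheory.EllipticCurves.GreenbergSelmer
  Literature.NumberTheory.GaloisRepresentations

namespace Summit.BirchSwinnertonDyer.BirchSwinnertonDyer.Cruxes.ErratumThm23SigmaLeSelfDual.ErratumChain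

/-! ## Registered stubs -/

/-- **S1♭† · `stub_FW21_twoVarSigmaLeDivPinned_selfDual`** (v4♭, imc-p1 g34: the pin's cofactor is NOT asked to be a unit) — the OPEN
two-variable core (FW21 Thm. 4.41, Σ-imprimitive, ♭-pinned to `L^Σ_p(g)` — «`L^Σ_p(g)` DIVIDES the anticyclotomic restriction» — by
FW21 App. B Cor. 7.21 ∕ L. 7.22 + the weight-`k` CGS calculation + Hsieh2014 Thm. B) FOR THE ERRATUM'S OWN MODULE: the registered S1† of
`Lines/erratum_chain.lean` v3‡ BYTE-IDENTICAL except for the ♭ pin; Galois module = the SELF-DUAL Tate twist — `X^Σ_K(A_g^†) := XBig κ'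
(AnticyclotomicBigGaloisRep κ (Δ.selfDualCofreeRepOver K)) 𝔭bar Σ` (`OrdinaryNewformDatumSelfDualTwist`; TWIST AUDIT imc-p1 g24). For `A_g^†`
the anticyclotomic specialisation IS `T_c = 0`; the ♭ pin `constantCoeff Q₂ = c * Q` asks only that `Q` DIVIDES `Q₂(T_c = 0)`.
[claim: FouquetWan2021, Thm. 4.41 + App. B Cor. 7.21, status: under-review] [cite: CastellaGrossiSkinner2025, Prop. 2.4.5] [cite: Hsieh2014, Thm. B]
[cite: Castella2018Erratum, §2 (p. 2: "the self-dual Tate twist"), (2.4)] -/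
theorem stub_FW21_twoVarSigmaLeDivPinned_selfDual :
    ∀ {p : ℕ} [Fact p.Prime] (ι : PadicAlgCl p ≃+* ℂ) {M : ℕ} [NeZero M] {k : ℤ}
      (g : CuspForm (CongruenceSubgroup.Gamma0 M) k) (ιg : coeffField g →+* PadicAlgCl p)
      (Δ : OrdinaryNewformDatum g p ιg)
      (K : Type) [Field K] [NumberField K] (𝔭 𝔭bar : HeightOneSpectrum (𝓞 K)) (κ : ZpExtension K p)
      (γ : absoluteGaloisGroup K) [Fact (κ.IsTopGenerator γ)] (S : Finset (HeightOneSpectrum (𝓞 K))),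
      IsNewform0 g → 2 ≤ k → Even k → 3 ≤ M → ¬ p ∣ M → 3 < p →
      (∀ x : coeffField g, ι (ιg x) = (x : ℂ)) →
      ‖ιg ⟨(UpperHalfPlane.qExpansion 1 ⇑g).coeff p, coeff_mem_coeffField g p⟩‖ = 1 →
      IsImaginaryQuadratic K → (∃ β : ℤ, (4 * M : ℤ) ∣ β ^ 2 - NumberField.discr K) →
      ((Ideal.span {(p : ℤ)}).primesOver (𝓞 K)).ncard = 2 →
      ((p : ℕ) : 𝓞 K) ∈ 𝔭.asIdeal →
      (∀ (w : InfinitePlace K) (x : 𝓞 K), x ∈ 𝔭.asIdeal ↔ ‖ι.symm (w.embedding (x : K))‖ < 1) →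
      ((p : ℕ) : 𝓞 K) ∈ 𝔭bar.asIdeal → 𝔭bar ≠ 𝔭 →
      SkinnerUrban2014.IsResiduallyIrreducible Δ →
      (∃ v : HeightOneSpectrum (𝓞 ℚ), SkinnerUrban2014.IsResiduallyRamifiedAt Δ v ∧
        ((Rat.HeightOneSpectrum.primesEquiv v : Nat.Primes) : ℕ) ∣ M ∧
        ¬ ((Rat.HeightOneSpectrum.primesEquiv v : Nat.Primes) : ℕ) ^ 2 ∣ M ∧
        ((Ideal.span {(((Rat.HeightOneSpectrum.primesEquiv v : Nat.Primes) : ℕ) : ℤ)}).primesOver (𝓞 K)).ncard ≠ 2) →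
      (((Ideal.span {(2 : ℤ)}).primesOver (𝓞 K)).ncard ≠ 2 → (2 ∣ M ∧ ¬ 4 ∣ M)) →
      (∀ ℓ : ℕ, ℓ.Prime → ℓ ∣ M → ((Ideal.span {(ℓ : ℤ)}).primesOver (𝓞 K)).ncard ≠ 2 →
        ¬ ℓ ^ 2 ∣ M ∧ (UpperHalfPlane.qExpansion 1 ⇑g).coeff ℓ = -((ℓ : ℂ) ^ (k / 2 - 1).toNat)) →
      κ.IsAnticyclotomic → (∀ w ∈ S, ((p : ℕ) : 𝓞 K) ∉ w.asIdeal) →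
      (∀ w : HeightOneSpectrum (𝓞 K), ((M : ℕ) : 𝓞 K) ∈ w.asIdeal → w ∈ S) →
      ∀ (b : padicCoeffIntegers ιg →+* PadicComplexInt p),
        (∀ x, ((b x : PadicComplexInt p) : ℂ_[p]) =
          algebraMap (PadicAlgCl p) ℂ_[p] (padicCoeffIntegers.toPadicAlgCl ιg x)) →
      ∀ (ΩK : ℂ) (Ωp : (PadicComplexInt p)ˣ) (Q : PowerSeries (PadicComplexInt p)), ΩK ≠ 0 →
        IsBDPLFunctionWtSigmaInt ι 𝔭 κ γ g S ΩK ((Ωp : PadicComplexInt p) : ℂ_[p]) Q →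
      -- the complementary (cyclotomic) direction `κ'` with generator `γ'`: `Γ_K = Γ⁺ ⊕ Γ⁻ ≅ ℤ_p²` for `p` odd
      ∀ (κ' : ZpExtension K p) (γ' : absoluteGaloisGroup K) [Fact (κ'.IsTopGenerator γ')], κ'.IsCyclotomic →
      ∀ [TopologicalSpace (PowerSeries (padicCoeffIntegers ιg))]
        [TopologicalSpace (PowerSeries (PowerSeries (padicCoeffIntegers ιg)))]
        [ContinuousSMul (PowerSeries (PowerSeries (padicCoeffIntegers ιg)))
          (BigRepModule (PowerSeries (padicCoeffIntegers ιg)) p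
            (BigRepModule (padicCoeffIntegers ιg) p (Cofree Δ.selfDualRep (padicCoeffField ιg))))],
      -- premise: `X^Σ_K(A_g)` is `Λ_K`-torsion; conclusion: a two-variable frame pinned to `Q` on `X = 0` dividing `Ch_{Λ_K}(X^Σ_K(A_g))`
      Module.IsTorsion (PowerSeries (PowerSeries (padicCoeffIntegers ιg)))
          (XBig κ' (AnticyclotomicBigGaloisRep κ (Δ.selfDualCofreeRepOver K)) 𝔭bar (↑S)) →
      ∃ Q₂ : PowerSeries (PowerSeries (PadicComplexInt p)),
        -- ♭ pin (v4♭, imc-p1 g34): the frame `Q` DIVIDES `Q₂(T_c = 0)` — any cofactor `c`, NOT asked to be a unit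
        (∃ c : PowerSeries (PadicComplexInt p), PowerSeries.constantCoeff Q₂ = c * Q) ∧
        (XBig.charIdeal κ' (AnticyclotomicBigGaloisRep κ (Δ.selfDualCofreeRepOver K)) 𝔭bar (↑S)).map
            (PowerSeries.map (PowerSeries.map b)) ≤ Ideal.span {Q₂} := by
  sorry

/-! ## Stub statements by name -/

namespace Statement

/-- Statement of `stub_FW21_twoVarSigmaLeDivPinned_selfDual` (the open two-variable core, self-dual module, ♭ pin). -/
abbrev stub_FW21_twoVarSigmaLeDivPinned_selfDual : Prop := type_of% @ErratumChain.stub_FW21_twoVarSigmaLeDivPinned_selfDual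

end Statement

/-! ## The composition (sorry-free): the stub STATEMENT and the route item 23081 imply the crux, BY NAME -/

/-- **`ErratumThm23SigmaLeSelfDual_of`** (v4♭) — the erratum's chain BY NAME, over ONE stub (S1♭†) and ONE route item
(`ErratumRoadFive.HidaOrdinaryUnitRootFact`, aside 23081 = [Wiles88 Thm 2.2 ∕ Hida00 Thm 3.26 (2)], which unfolds definitionally to
`Literature.NumberTheory.EllipticCurves.Hida2000_thm326_ordinary_unitRoot`): the tree theorem
`Theorems.ErratumThm23TwoVariable.ErratumChainSelfDualDivPin.erratumThm23SigmaLeSelfDual_of_twoVarCoreDivPin_of_thm326` (imc-p1 g34: descent +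
control + finite local defect ⟸ (FIX)† ⟸ [W], ♭ pin). Pure logic here. [cite: Castella2018Erratum, (2.4) ⇒ (2.5) (p. 4)] [cite: Wiles1988, Thm. 2.2] -/
theorem ErratumThm23SigmaLeSelfDual_of (hFW : Statement.stub_FW21_twoVarSigmaLeDivPinned_selfDual)
    (hW : Summit.BirchSwinnertonDyer.BirchSwinnertonDyer.Theses.ErratumRoadFive.HidaOrdinaryUnitRootFact) :
    Summit.BirchSwinnertonDyer.BirchSwinnertonDyer.Theses.ErratumRoadFive.ErratumThm23SigmaLeSelfDual :=
  Summit.BirchSwinnertonDyer.BirchSwinnertonDyer.Theorems.ErratumThm23TwoVariable.ErratumChainSelfDualDivPin.erratumThm23SigmaLeSelfDual_of_twoVarCoreDivPin_of_thm326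
    hFW hW

/-- The crux† along this line — v4♭: MODULO the route item 23081 (binder) and exactly the ONE stub S1♭† (the only `sorry` lives in
`stub_FW21_twoVarSigmaLeDivPinned_selfDual`). -/
theorem ErratumThm23SigmaLeSelfDual_proof
    (hW : Summit.BirchSwinnertonDyer.BirchSwinnertonDyer.Theses.ErratumRoadFive.HidaOrdinaryUnitRootFact) :
    Summit.BirchSwinnertonDyer.BirchSwinnertonDyer.Theses.ErratumRoadFive.ErratumThm23SigmaLeSelfDual :=
  ErratumThm23SigmaLeSelfDual_of stub_FW21_twoVarSigmaLeDivPinned_selfDual hW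

end Summit.BirchSwinnertonDyer.BirchSwinnertonDyer.Cruxes.ErratumThm23SigmaLeSelfDual.ErratumChain

end
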